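import Summits.QuantumFields.YangMills.Theorems.FluctuationComparisonRegPrIntLOrganTangentFibredChartDescendTo
import HarnessLib

/-!
# `FluctuationComparisonRegPrIntLOrganTangentTowerCutIterate` — (L18) «CLAUSE ⑦ ITERATED»: the one-step cut consistency of an SF-projected tower,
# `μ n = (descend n)_* (w_{n+1} · μ_{n+1})`, iterates to `μ j = (descendTo j K)_* ((∏_{j<n≤K} w_n ∘ descendTo n K) · μ_K)` — the `mY`∕consistency input of KNIT-MW (✓(L17))

Cell `ym3-torus` (rung R3 = continuum `SU(2)` Yang–Mills on T³ — NOT d = 4, NOT infinite volume, NOT a mass gap, NOT Clay), width seat `ym-ust-20520-w5` (gen 22),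
pen (L18) (offered 2026-08-31 00:31Z to LEAD-20520 w3 g24 ∕ ideator g27).  `--kind proof --supports stmt-QuantumFields-20520 --as helper`, count-neutral, definition-free,
default heartbeats; THEOREMS ONLY; nothing printed is asserted.

WHAT.  O1's frame (`Lines/runpair_organ.lean` v17.2, clause ⑦) SF-projects the towers level by level below the seed:
`μ j = Measure.map (descend F ℰp j) ((μ (j+1)).withDensity (fun U => ENNReal.ofReal (sfCut θ_{j+1} U)))`.  The v18 m-step rows (V18-TYPING-SPEC §3) read the composite
`descendTo F ℰp j K`; their fibre-mean VERSION is ✓(L17) `…FibreMeanVersionKnitDescendTo`, whose consistency input is SOME `mY ≪ dU_K` with `mY.map (descendTo j K) = ρ_j·dU_j`.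
This file iterates clause ⑦ for a GENERIC measurable weight family `w n : G_n → ℝ≥0∞` (the rows instantiate `w n := ofReal ∘ sfCut θ_n`):
★★ `towerCut_iterate`: if `μ n = (descend F ℰp n)_* ((μ (n+1)).withDensity (w (n+1)))` for every `n ∈ [j, K)`, then
`μ j = (descendTo F ℰp j K)_* ((μ K).withDensity (fun U => ∏ i ∈ Finset.range (K − j), w (j+1+i) (descendTo F ℰp (j+1+i) K U)))`
(the factor is written `if h : j+1+i ≤ K then w (j+1+i) (descendTo F ℰp (j+1+i) K h U) else 1` so that no proof term depends on the `Finset` membership; inside the range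
the condition holds), by induction on `K` over lit ✓`T4TriangularFibredChart.map_withDensity_comp_eq`, `MeasureTheory.withDensity_mul`, ✓`descendTo_descendTo`, ✓`descend_eq_descendTo'`.
Small tools: `weight_top` (the `n = K` factor is `w K U`), `measurable_iterWeight`.
NOT HERE: the v18 row texts; nothing of Bałaban's estimates.
[cite: Balaban1987RG1, (0.4) p.253 and (0.11) p.253; Balaban1985Averaging, (10)-(13) p.19; Balaban1985UV3, (7) p.257]

HONEST: measure-theoretic plumbing; nothing of Bałaban's RG estimates is asserted or proved; O1 ∕ O1ᵘ-H ∕ m-step rows ∕ crux 20520 `FluctuationComparisonRegPrIntL` ∕ `YM3TorusSU2`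
NOT proved; registry `Lines/semiclassical_s2beta.lean` v11.4 (★★OWNER RULING №36) untouched; rung R3 = SU(2) YM₃ on T³ — NOT d = 4, NOT infinite volume, NOT a mass gap,
NOT Clay; the Yang–Mills mass gap is NOT proved by any of this.
-/

set_option autoImplicit false

noncomputable section

namespace Summit.QuantumFields.YangMills.Theorems.FluctuationComparisonRegPrIntLOrganTangentTowerCutIterate

open MeasureTheory Filter Topology Set Function
open scoped ENNReal NNReal
open Literature.MathematicalPhysics.QuantumFieldTheory.Balaban1983to89
open T3ContinuumYM3Torus T3NestedUnitLaws T3UnitLawDensityEML T3UnitScaleTilt T3LevelShift T3TiltDescent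
open Literature.MathematicalPhysics.QuantumFieldTheory.Balaban1983to89.T3DescentFibreTower (descendTo_descendTo descendTo_self)
open Summit.QuantumFields.YangMills.Theorems.FluctuationComparisonRegPrIntLOrganTangentFibredChartDescendTo (descend_eq_descendTo')

/-! ## Small tools -/

/-- The factor at a level EQUAL to the top is the weight itself (transport along `n = K`, then ✓`descendTo_self`). [folklore] -/
theorem weight_top (F : T3Family) (w : (n : ℕ) → GaugeField (F.P n) 0 ↥(Matrix.specialUnitaryGroup (Fin 2) ℂ) → ℝ≥0∞) (K : ℕ) :
    ∀ (n : ℕ) (hn : n = K) (h : n ≤ K) (U : GaugeField (F.P K) 0 ↥(Matrix.specialUnitaryGroup (Fin 2) ℂ)), w n (descendTo F ℰp n K h U) = w K U := by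
  intro n hn h U
  subst hn
  rw [descendTo_self]

/-- The iterated weight is measurable. [folklore] -/
theorem measurable_iterWeight (F : T3Family) (w : (n : ℕ) → GaugeField (F.P n) 0 ↥(Matrix.specialUnitaryGroup (Fin 2) ℂ) → ℝ≥0∞)
    (hw : ∀ n, Measurable (w n)) (j K N : ℕ) :
    Measurable fun U : GaugeField (F.P K) 0 ↥(Matrix.specialUnitaryGroup (Fin 2) ℂ) =>
      ∏ i ∈ Finset.range N, (if h : j + 1 + i ≤ K then w (j + 1 + i) (descendTo F ℰp (j + 1 + i) K h U) else 1) := by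
  refine Finset.measurable_prod _ fun i _ => ?_
  by_cases h : j + 1 + i ≤ K
  · simp only [h, dif_pos]
    exact (hw _).comp (measurable_descendTo F ℰp measurableE_ℰp h)
  · simp only [h, dif_neg, not_false_eq_true]
    exact measurable_const

/-! ## Clause ⑦ iterated -/

/-- ★★ **THE ONE-STEP CUT CONSISTENCY ITERATES ALONG `descendTo`.**  For a tower of measures `μ n` on `GaugeField (F.P n)` and a measurable weight family `w n`, if
`μ n = (descend F ℰp n)_* ((μ (n+1)).withDensity (w (n+1)))` for every `n` with `j ≤ n < K`, then
`μ j = (descendTo F ℰp j K)_* ((μ K).withDensity (fun U => ∏_{i < K−j} w (j+1+i) (descendTo F ℰp (j+1+i) K U)))`.  Clause ⑦ of O1's frame is the instance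
`w n := ofReal ∘ sfCut θ_n` (`n < Ts`); the conclusion is the `mY`∕`hcons` input of ✓(L17) KNIT-MW with `mY := (μ K).withDensity (iterated weight)` when `μ n = ρ_n·dU_n`.
[cite: Balaban1987RG1, (0.11) p.253; Balaban1985Averaging, (10)-(13) p.19; Balaban1985UV3, (7) p.257] -/
theorem towerCut_iterate (F : T3Family)
    (μ : (n : ℕ) → Measure (GaugeField (F.P n) 0 ↥(Matrix.specialUnitaryGroup (Fin 2) ℂ)))
    (w : (n : ℕ) → GaugeField (F.P n) 0 ↥(Matrix.specialUnitaryGroup (Fin 2) ℂ) → ℝ≥0∞) (hw : ∀ n, Measurable (w n))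
    (j : ℕ) : ∀ (K : ℕ) (hjK : j ≤ K),
      (∀ n, j ≤ n → n < K → μ n = Measure.map (descend F ℰp n) ((μ (n + 1)).withDensity (w (n + 1)))) →
      μ j = Measure.map (descendTo F ℰp j K hjK) ((μ K).withDensity fun U =>
        ∏ i ∈ Finset.range (K - j), (if h : j + 1 + i ≤ K then w (j + 1 + i) (descendTo F ℰp (j + 1 + i) K h U) else 1)) := by
  intro K hjK
  induction K, hjK using Nat.le_induction with
  | base =>
    intro _
    have e : (descendTo F ℰp j j le_rfl : GaugeField (F.P j) 0 ↥(Matrix.specialUnitaryGroup (Fin 2) ℂ) → GaugeField (F.P j) 0 ↥(Matrix.specialUnitaryGroup (Fin 2) ℂ)) = id :=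
      funext fun U => descendTo_self F ℰp j U
    simp only [Nat.sub_self, Finset.range_zero, Finset.prod_empty]
    rw [e, Measure.map_id]
    exact (withDensity_one).symm
  | succ K hjK IH =>
    intro hcut
    -- the IH up to `K` and the one-step clause at `K`
    have hIH := IH fun n hjn hnK => hcut n hjn (by omega)
    have hK := hcut K hjK (Nat.lt_succ_self K)
    have hd : Measurable (descend F ℰp K : GaugeField (F.P (K + 1)) 0 ↥(Matrix.specialUnitaryGroup (Fin 2) ℂ) → GaugeField (F.P K) 0 ↥(Matrix.specialUnitaryGroup (Fin 2) ℂ)) :=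
      T3NestedUnitLaws.measurable_descend F ℰp measurableE_ℰp K
    have hdK : Measurable (descendTo F ℰp j K hjK : GaugeField (F.P K) 0 ↥(Matrix.specialUnitaryGroup (Fin 2) ℂ) → GaugeField (F.P j) 0 ↥(Matrix.specialUnitaryGroup (Fin 2) ℂ)) :=
      measurable_descendTo F ℰp measurableE_ℰp hjK
    -- names for the two weights
    set WK : GaugeField (F.P K) 0 ↥(Matrix.specialUnitaryGroup (Fin 2) ℂ) → ℝ≥0∞ := fun U =>
      ∏ i ∈ Finset.range (K - j), (if h : j + 1 + i ≤ K then w (j + 1 + i) (descendTo F ℰp (j + 1 + i) K h U) else 1) with hWK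
    have hWKm : Measurable WK := measurable_iterWeight F w hw j K (K - j)
    -- Step 1: push the IH weight through the one-step clause
    have h1 : (μ K).withDensity WK = Measure.map (descend F ℰp K) (((μ (K + 1)).withDensity (w (K + 1))).withDensity fun U => WK (descend F ℰp K U)) := by
      rw [hK]
      exact (T4TriangularFibredChart.map_withDensity_comp_eq _ hd hWKm).symm
    -- Step 2: the two weights multiply
    have h2 : ((μ (K + 1)).withDensity (w (K + 1))).withDensity (fun U => WK (descend F ℰp K U)) =
        (μ (K + 1)).withDensity fun U => w (K + 1) U * WK (descend F ℰp K U) := by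
      have hm2 : Measurable fun U : GaugeField (F.P (K + 1)) 0 ↥(Matrix.specialUnitaryGroup (Fin 2) ℂ) => WK (descend F ℰp K U) := hWKm.comp hd
      rw [show (fun U => w (K + 1) U * WK (descend F ℰp K U)) = (w (K + 1)) * (fun U => WK (descend F ℰp K U)) from rfl,
        withDensity_mul _ (hw _) hm2]
    -- Step 3: the product weight IS the iterated weight at `K + 1`
    have h3 : (fun U : GaugeField (F.P (K + 1)) 0 ↥(Matrix.specialUnitaryGroup (Fin 2) ℂ) => w (K + 1) U * WK (descend F ℰp K U)) = fun U =>
        ∏ i ∈ Finset.range (K + 1 - j), (if h : j + 1 + i ≤ K + 1 then w (j + 1 + i) (descendTo F ℰp (j + 1 + i) (K + 1) h U) else 1) := by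
      funext U
      rw [show K + 1 - j = K - j + 1 by omega, Finset.prod_range_succ, mul_comm]
      congr 1
      · -- the factors below the top: `descendTo n (K+1) U = descendTo n K (descend K U)`
        refine Finset.prod_congr rfl fun i hi => ?_
        have hi' : i < K - j := Finset.mem_range.1 hi
        have hle : j + 1 + i ≤ K := by omega
        have hle' : j + 1 + i ≤ K + 1 := by omega
        rw [dif_pos hle, dif_pos hle', descend_eq_descendTo' F K (Nat.le_succ K) U, descendTo_descendTo]
      · -- the top factor: `j + 1 + (K - j) = K + 1`
        have hle : j + 1 + (K - j) ≤ K + 1 := by omega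
        rw [dif_pos hle]
        exact (weight_top F w (K + 1) (j + 1 + (K - j)) (by omega) hle U).symm
    -- assemble
    rw [hIH, h1, Measure.map_map hdK hd, h2, h3]
    have e : (descendTo F ℰp j K hjK ∘ descend F ℰp K :
        GaugeField (F.P (K + 1)) 0 ↥(Matrix.specialUnitaryGroup (Fin 2) ℂ) → GaugeField (F.P j) 0 ↥(Matrix.specialUnitaryGroup (Fin 2) ℂ)) =
        descendTo F ℰp j (K + 1) (by omega) := by
      funext U
      show descendTo F ℰp j K hjK (descend F ℰp K U) = descendTo F ℰp j (K + 1) _ U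
      rw [descend_eq_descendTo' F K (Nat.le_succ K) U, descendTo_descendTo]
    rw [e]

end Summit.QuantumFields.YangMills.Theorems.FluctuationComparisonRegPrIntLOrganTangentTowerCutIterate

end
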